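import Summits.AtomisticToContinuum.Crystallization.Theorems.ChartedZeroExcessLayeredLatticeLiouvilleZZZYRG

/-!
# ZZZYRJ — line (D) on the ENERGY-NEAR class: the door (U♯-W-E), the energy enclosure (EE), the cells' energy-free target U_Q, the glue,
# and the glue to the column slot `hU` BY NAME (decomp-a2c lens-2 «special vs generic», gen 104; binder `ChartedPlanarOrder.ChartedZeroExcessLayered`
# (stmt 26636), line (D); architecture of record (γ-E), critic r1937 (B), checks C1–C4)

THE DICHOTOMY.  Line (D)'s target of record (U♯-W) `UniformEquilStabilityAtIn s Λ κ₀ c₀ W` (ZZZYRE) asks ONE coercivity constant for every clean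
single-site-Nash equilibrium chart with scale in `W` — homogeneously strained words included — and its certificate is knife-edge (κ* = 0.0012, r1933 (B)).
The SPECIAL class the summit's consumer actually meets is the ENERGY-NEAR class (`IsEnergyNear ν`, TP §XVII.1: every site energy `≤ e⋆ + ν`): the
column of record `gap_and_pert_1_50_of_certs_16XH28BP` (YN) consumes stability ONLY as `hU : UniformTameStabilityE (1/50) 2 (1/2000)` (TP §XVII.2),
the energy hypothesis being discharged inside the column by the supplier slot `hN : EnergyNearChartPX …` (TPb l.131).  The GENERIC class (clean Nash
charts that are not energy-near) is never entered.  Pieces (r1937 (B) C4):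
§1 the door (U♯-W-E) `UniformEquilStabilityAtEIn s Λ κ₀ c₀ ν W` and its TAME twin (U♮-W-E) `UniformTameStabilityAtEIn s Λ κ₀ c₀ C₁ ν W` (the form
   that lands on `hU`), monotonicity, union; the door of record is the `ν`-free case (`UniformEquilStabilityAtIn.toE`).
§2 (EE) `EnergyEnclosureP s Λ c₀ ℓ₀ t Q W` — ONE def, the parameter window `Q` AND the energy threshold `t` parameters: every admissible word at a scale
   `a ∈ W` all of whose site energies are `≤ t` lies in `Q`.  The critic's (EE) is the instance `t = eStar + ν`; the CERTIFIABLE instance is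
   `t = eUp + ν` for a certified periodic ceiling `e(P) ≤ eUp` (tree: `FrustratedLawDichotomyPeriodicEnergyCeilingKernel.eStar_le : eStar ≤ −0.7175`,
   standard axioms), and C1 = `EnergyEnclosureP.of_ceiling` (via the tree lemma `ChargedEnergyGapNegative.eStar_le P : eStar ≤ e(P)`): the κ₀
   certificate needs NO lower bound on `e⋆`.  U_Q = `WordStabilityP s Λ c₀ ℓ₀ κ₀ CanQ`: ENERGY-FREE word-level coercivity over the class-in-`Q` — what
   the cells certify (`wordStabilityP_of_atlas`, the budget half of ZZZYRE's door VERBATIM).  ★★ GLUE (PROVED)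
   `uniformTameStabilityAtEIn_of_enclosure_of_cells : (RI♯-C-W) → (EE)(eStar + ν, Q) → U_Q(Can ∧ W ∧ Q) → (U♮-W-E)` (tameness `C₁ = max Λ ℓ₀` is read off
   the re-indexing leaf and `norm_gen_le`), and its (U♯-W-E) corollary.
§3 ★★ GLUE TO THE COLUMN SLOT (PROVED): (U♮-W-E) with positive constants ∧ (ECOVER) `EnergyScaleCoverP s Λ ν W` ⇒ `UniformTameStabilityE s Λ ν` = `hU`
   BY NAME (no (D₀) `TameReindex`); strata form with the coarse re-chart leaf (RECHART-E) `CoarseRechartTEP`.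
The concrete `Q` of record (letter box `[amin, amax] × E-band`, census SURV61/EBAND61/CERTSIZE61) is the companion ZZZYRK.
0 sorry · no instance / notation / macro / set_option · import = tree ZZZYRG (⊇ ZZZYRE; `norm_gen_le`) · tree currencies by name. [g104]
-/

noncomputable section

namespace Summit.AtomisticToContinuum.Crystallization.Theorems.ChartedZeroExcessLayeredLatticeLiouville

open scoped BigOperators RealInnerProductSpace
open Summit.AtomisticToContinuum.Crystallization.Theorems.ChartedPlanarOrderRigidityDoor (E3 eStar siteEnergy)
open Summit.AtomisticToContinuum.Crystallization.Theorems.ChartedPlanarOrderDensityDichotomy (μS)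
open Summit.AtomisticToContinuum.Crystallization.Theorems.ChartedPlanarOrderMesoCut (LayeredHom)
open Summit.AtomisticToContinuum.Crystallization.Theorems.ChartedPlanarOrderDoorLayered (Layered)
open Literature.MathematicalPhysics.StatisticalMechanics (triangularVec₁ triangularVec₂ PeriodicConfiguration lennardJones)

variable {ι : Type*}

/-! ### §1 the energy-windowed doors, constants in front -/

/-- ★ **(U♯-W-E) «UniformEquilStabilityAtEIn s Λ κ₀ c₀ ν W»** (door of record of line (D) under (γ-E), r1937 (B)) — (U♯-W) `UniformEquilStabilityAtIn`
(ZZZYRE) restricted to equilibrium charts whose homogeneous layered set is `ν`-energy-near (`IsEnergyNear ν`, TP §XVII.1).  STABILITY-type · UNDECIDED ·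
CERT · INSTRUMENTABLE (census SURV61/CERTSIZE61: instance ν = 1/2000 ⇒ κ ≥ 0.054 inside the class [min-step], ×45 over the knife edge).
Why it might fail: a soft phonon of a ≤ 1.8 %-strained energy-near clean Nash Barlow word, or loss of uniformity of κ₀ along aperiodic words.
Sources: tree TP `UniformTameStabilityE`; ZZZYRE; Hudson–Ortner doi:10.1051/m2an/2011014; E–Ming 2006 §2. [g104] -/
def UniformEquilStabilityAtEIn (s Λ κ₀ c₀ ν : ℝ) (W : Set ℝ) : Prop :=
  ∀ a : ℝ, a ∈ W → 0 < a →
    ∀ (L : E3 ≃L[ℝ] E3) (w : ℤ → E3), IsEquilChart a s Λ L w → IsEnergyNear ν (LayeredHom (L : E3 →L[ℝ] E3) w) →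
      ∃ w' : ℤ → E3,
        Layered ((L : E3 →L[ℝ] E3) (triangularVec₁ 1)) ((L : E3 →L[ℝ] E3) (triangularVec₂ 1)) w' = LayeredHom (L : E3 →L[ℝ] E3) w ∧
        IsLayeredCrystal c₀ ((L : E3 →L[ℝ] E3) (triangularVec₁ 1)) ((L : E3 →L[ℝ] E3) (triangularVec₂ 1)) w' ∧
        CoerciveZ (layeredKernel ((L : E3 →L[ℝ] E3) (triangularVec₁ 1)) ((L : E3 →L[ℝ] E3) (triangularVec₂ 1)) w') κ₀

/-- ★★ **(U♮-W-E) «UniformTameStabilityAtEIn s Λ κ₀ c₀ C₁ ν W»** — the TAME twin: the four clauses of (U♮ᴱ) `UniformTameStabilityE s Λ ν` (TP §XVII.2,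
the column slot `hU`) with the constants `(κ₀, c₀, C₁)` in front and the scale restricted to `W`; what §3 glues to `hU`. [g104] -/
def UniformTameStabilityAtEIn (s Λ κ₀ c₀ C₁ ν : ℝ) (W : Set ℝ) : Prop :=
  ∀ a : ℝ, a ∈ W → 0 < a →
    ∀ (L : E3 ≃L[ℝ] E3) (w : ℤ → E3), IsEquilChart a s Λ L w → IsEnergyNear ν (LayeredHom (L : E3 →L[ℝ] E3) w) →
      ∃ w' : ℤ → E3,
        Layered ((L : E3 →L[ℝ] E3) (triangularVec₁ 1)) ((L : E3 →L[ℝ] E3) (triangularVec₂ 1)) w' = LayeredHom (L : E3 →L[ℝ] E3) w ∧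
        IsLayeredCrystal c₀ ((L : E3 →L[ℝ] E3) (triangularVec₁ 1)) ((L : E3 →L[ℝ] E3) (triangularVec₂ 1)) w' ∧
        IsTameIndexing C₁ ((L : E3 →L[ℝ] E3) (triangularVec₁ 1)) ((L : E3 →L[ℝ] E3) (triangularVec₂ 1)) w' ∧
        CoerciveZ (layeredKernel ((L : E3 →L[ℝ] E3) (triangularVec₁ 1)) ((L : E3 →L[ℝ] E3) (triangularVec₂ 1)) w') κ₀

/-- the door of record implies (U♯-W-E) for every `ν`: (U♯-W) is the case «`ν = ∞`». [g104] -/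
theorem UniformEquilStabilityAtIn.toE {s Λ κ₀ c₀ : ℝ} {W : Set ℝ} (h : UniformEquilStabilityAtIn s Λ κ₀ c₀ W) (ν : ℝ) :
    UniformEquilStabilityAtEIn s Λ κ₀ c₀ ν W := fun a haW ha L w hE _ => h a haW ha L w hE

/-- (U♯-W-E): a smaller tolerance is a weaker claim. [g104] -/
theorem UniformEquilStabilityAtEIn.anti {s Λ κ₀ c₀ ν ν' : ℝ} {W : Set ℝ} (hle : ν' ≤ ν) (h : UniformEquilStabilityAtEIn s Λ κ₀ c₀ ν W) :
    UniformEquilStabilityAtEIn s Λ κ₀ c₀ ν' W := fun a haW ha L w hE hN => h a haW ha L w hE (hN.mono hle)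

/-- (U♯-W-E): a smaller window is a weaker claim. [g104] -/
theorem UniformEquilStabilityAtEIn.mono {s Λ κ₀ c₀ ν : ℝ} {W W' : Set ℝ} (hW : W' ⊆ W) (h : UniformEquilStabilityAtEIn s Λ κ₀ c₀ ν W) :
    UniformEquilStabilityAtEIn s Λ κ₀ c₀ ν W' := fun a haW ha L w hE hN => h a (hW haW) ha L w hE hN

/-- (U♯-W-E): smaller constants are a weaker claim. [g104] -/
theorem UniformEquilStabilityAtEIn.of_le {s Λ κ₀ c₀ κ₀' c₀' ν : ℝ} {W : Set ℝ} (hκ : κ₀' ≤ κ₀) (hc : c₀' ≤ c₀)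
    (h : UniformEquilStabilityAtEIn s Λ κ₀ c₀ ν W) : UniformEquilStabilityAtEIn s Λ κ₀' c₀' ν W := by
  intro a haW ha L w hE hN
  obtain ⟨w', hset, hco, hcoer⟩ := h a haW ha L w hE hN
  exact ⟨w', hset, hco.of_le hc, hcoer.of_le hκ⟩

/-- (U♯-W-E) UNION GLUE: two windows ⇒ the union with the minima. [g104] -/
theorem UniformEquilStabilityAtEIn.union {s Λ κ₁ c₁ κ₂ c₂ ν : ℝ} {W₁ W₂ : Set ℝ} (h₁ : UniformEquilStabilityAtEIn s Λ κ₁ c₁ ν W₁)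
    (h₂ : UniformEquilStabilityAtEIn s Λ κ₂ c₂ ν W₂) : UniformEquilStabilityAtEIn s Λ (min κ₁ κ₂) (min c₁ c₂) ν (W₁ ∪ W₂) := by
  intro a haW ha L w hE hN
  rcases haW with h | h
  · exact (h₁.of_le (min_le_left _ _) (min_le_left _ _)) a h ha L w hE hN
  · exact (h₂.of_le (min_le_right _ _) (min_le_right _ _)) a h ha L w hE hN

/-- (U♯-W-E) transports along an energy scale cover (§3) — stated here for the cover-free reading: a window containing every relevant scale. [g104] -/
theorem UniformEquilStabilityAtEIn.of_forall {s Λ κ₀ c₀ ν : ℝ} {W W' : Set ℝ}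
    (hcov : ∀ a : ℝ, 0 < a → ∀ (L : E3 ≃L[ℝ] E3) (w : ℤ → E3), IsEquilChart a s Λ L w → IsEnergyNear ν (LayeredHom (L : E3 →L[ℝ] E3) w) → a ∈ W)
    (h : UniformEquilStabilityAtEIn s Λ κ₀ c₀ ν W) : UniformEquilStabilityAtEIn s Λ κ₀ c₀ ν W' :=
  fun a _ ha L w hE hN => h a (hcov a ha L w hE hN) ha L w hE hN

/-- forgetting tameness. [g104] -/
theorem UniformTameStabilityAtEIn.toEquil {s Λ κ₀ c₀ C₁ ν : ℝ} {W : Set ℝ} (h : UniformTameStabilityAtEIn s Λ κ₀ c₀ C₁ ν W) :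
    UniformEquilStabilityAtEIn s Λ κ₀ c₀ ν W := by
  intro a haW ha L w hE hN
  obtain ⟨w', hset, hco, -, hcoer⟩ := h a haW ha L w hE hN
  exact ⟨w', hset, hco, hcoer⟩

/-- (U♮-W-E): a smaller tolerance is a weaker claim. [g104] -/
theorem UniformTameStabilityAtEIn.anti {s Λ κ₀ c₀ C₁ ν ν' : ℝ} {W : Set ℝ} (hle : ν' ≤ ν)
    (h : UniformTameStabilityAtEIn s Λ κ₀ c₀ C₁ ν W) : UniformTameStabilityAtEIn s Λ κ₀ c₀ C₁ ν' W :=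
  fun a haW ha L w hE hN => h a haW ha L w hE (hN.mono hle)

/-- (U♮-W-E): smaller `κ₀, c₀` and a larger `C₁` are a weaker claim. [g104] -/
theorem UniformTameStabilityAtEIn.of_le {s Λ κ₀ c₀ C₁ κ₀' c₀' C₁' ν : ℝ} {W : Set ℝ} (hκ : κ₀' ≤ κ₀) (hc : c₀' ≤ c₀) (hC : C₁ ≤ C₁')
    (h : UniformTameStabilityAtEIn s Λ κ₀ c₀ C₁ ν W) : UniformTameStabilityAtEIn s Λ κ₀' c₀' C₁' ν W := by
  intro a haW ha L w hE hN
  obtain ⟨w', hset, hco, hT, hcoer⟩ := h a haW ha L w hE hN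
  exact ⟨w', hset, hco.of_le hc, ⟨hT.1.trans hC, hT.2.1.trans hC, fun m => (hT.2.2 m).trans hC⟩, hcoer.of_le hκ⟩

/-- (U♮-W-E) UNION GLUE: two windows with their constants ⇒ the union with `(min κ, min c, max C)`. [g104] -/
theorem UniformTameStabilityAtEIn.union {s Λ κ₁ c₁ C₁ κ₂ c₂ C₂ ν : ℝ} {W₁ W₂ : Set ℝ}
    (h₁ : UniformTameStabilityAtEIn s Λ κ₁ c₁ C₁ ν W₁) (h₂ : UniformTameStabilityAtEIn s Λ κ₂ c₂ C₂ ν W₂) :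
    UniformTameStabilityAtEIn s Λ (min κ₁ κ₂) (min c₁ c₂) (max C₁ C₂) ν (W₁ ∪ W₂) := by
  intro a haW ha L w hE hN
  rcases haW with h | h
  · exact (h₁.of_le (min_le_left _ _) (min_le_left _ _) (le_max_left _ _)) a h ha L w hE hN
  · exact (h₂.of_le (min_le_right _ _) (min_le_right _ _) (le_max_right _ _)) a h ha L w hE hN

/-! ### §2 (EE) the energy enclosure, U_Q the cells' energy-free target, the glue, and C1 -/

/-- ★ **(EE) «EnergyEnclosureP s Λ c₀ ℓ₀ t Q W»** (r1937 (B) C2: the energy conjunct is load-bearing INSIDE the certificate) — every admissible word at a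
scale `a ∈ W` ALL of whose site energies are `≤ t` lies in the parameter window `Q` (a predicate on `(a, L, w')`, read by the cells' box dials;
`Q₂` = the two cells (0.9718, 1.0, 0 | .035) re-cut to the E-band, or `Q₁₄`, decided by the census rule argmin files(EE) + files(cells)).
The critic's (EE) is the instance `t = eStar + ν`; the certifiable one is `t = eUp + ν` with a certified periodic ceiling (`of_ceiling`).
EOS-type · UNDECIDED · INSTRUMENTABLE (explicit lattice sums + analytic tail: interval LOWER bounds of the site energy outside `Q`; census EOS61:
the site energy is convex on the projection box up to 0.5 %; margin ≈ 1.1·10⁻³ per site at ∂Q₂, ≥ 3.1·10⁻³ at ∂Q₁₄).  Why it might fail: a second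
energy-near branch of clean Nash words outside `Q` (none in census SURV61: all such cells have excess ≥ 4 ν). [g104] -/
def EnergyEnclosureP (s Λ c₀ ℓ₀ t : ℝ) (Q : ℝ → (E3 ≃L[ℝ] E3) → (ℤ → E3) → Prop) (W : Set ℝ) : Prop :=
  ∀ a : ℝ, a ∈ W → 0 < a → ∀ (L : E3 ≃L[ℝ] E3) (w' : ℤ → E3), IsAdmissibleWord a s Λ c₀ ℓ₀ L w' →
    (∀ x ∈ Layered (gen₁ L) (gen₂ L) w', siteEnergy (μS (Layered (gen₁ L) (gen₂ L) w')) x ≤ t) → Q a L w'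

/-- (EE) is antitone in the threshold (a lower threshold encloses a fortiori). [g104] -/
theorem EnergyEnclosureP.anti {s Λ c₀ ℓ₀ t t' : ℝ} {Q : ℝ → (E3 ≃L[ℝ] E3) → (ℤ → E3) → Prop} {W : Set ℝ} (hle : t ≤ t')
    (h : EnergyEnclosureP s Λ c₀ ℓ₀ t' Q W) : EnergyEnclosureP s Λ c₀ ℓ₀ t Q W :=
  fun a haW ha L w' hA hE => h a haW ha L w' hA fun x hx => (hE x hx).trans hle

/-- (EE) is monotone in `Q` and antitone in `W`. [g104] -/
theorem EnergyEnclosureP.imp {s Λ c₀ ℓ₀ t : ℝ} {Q Q' : ℝ → (E3 ≃L[ℝ] E3) → (ℤ → E3) → Prop} {W W' : Set ℝ} (hW : W' ⊆ W)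
    (hQ : ∀ a L w', Q a L w' → Q' a L w') (h : EnergyEnclosureP s Λ c₀ ℓ₀ t Q W) : EnergyEnclosureP s Λ c₀ ℓ₀ t Q' W' :=
  fun a haW ha L w' hA hE => hQ a L w' (h a (hW haW) ha L w' hA hE)

/-- ★ **C1 «e⋆ direction» (PROVED)**: a certified PERIODIC CEILING `e(P) ≤ eUp` turns the `e⋆`-free enclosure at threshold `eUp + ν` into the enclosure of
the `ν`-energy-near class (threshold `eStar + ν`), by the tree lemma `ChargedEnergyGapNegative.eStar_le P : eStar ≤ e(P)` (`e⋆` is a genuine infimum: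
LJ stability through blocks).  Instance of record: `eUp = −0.7175` from `FrustratedLawDichotomyPeriodicEnergyCeilingKernel.periodicEnergyCeiling_holds`
(standard axioms) — so the κ₀ certificate of line (D) needs NO lower bound on `e⋆` (free of the (411) bracket). [g104] -/
theorem EnergyEnclosureP.of_ceiling {s Λ c₀ ℓ₀ eUp ν : ℝ} {Q : ℝ → (E3 ≃L[ℝ] E3) → (ℤ → E3) → Prop} {W : Set ℝ}
    (hup : ∃ P : PeriodicConfiguration 3, P.energyPerParticle lennardJones ≤ eUp) (h : EnergyEnclosureP s Λ c₀ ℓ₀ (eUp + ν) Q W) :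
    EnergyEnclosureP s Λ c₀ ℓ₀ (eStar + ν) Q W := by
  obtain ⟨P, hP⟩ := hup
  -- `ChargedEnergyGapNegative.eStar` and `ChartedPlanarOrderRigidityDoor.eStar` are the same infimum (definitionally equal constants)
  have hle : eStar ≤ P.energyPerParticle lennardJones := ChargedEnergyGapNegative.eStar_le P
  exact h.anti (by linarith)

/-- ★ **U_Q «WordStabilityP s Λ c₀ ℓ₀ κ₀ CanQ»** — the cells' ENERGY-FREE target: every admissible word of the class `CanQ` (class-in-window-in-`Q`) has
`κ₀`-coercive layered kernel.  CERT (the existing reader / K-file template over the cells covering `Q`: `wordStabilityP_of_atlas`). [g104] -/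
def WordStabilityP (s Λ c₀ ℓ₀ κ₀ : ℝ) (CanQ : ℝ → (E3 ≃L[ℝ] E3) → (ℤ → E3) → Prop) : Prop :=
  ∀ a : ℝ, 0 < a → ∀ (L : E3 ≃L[ℝ] E3) (w' : ℤ → E3), IsAdmissibleWord a s Λ c₀ ℓ₀ L w' → CanQ a L w' →
    CoerciveZ (layeredKernel (gen₁ L) (gen₂ L) w') κ₀

/-- U_Q is antitone in the class and in `κ₀`. [g104] -/
theorem WordStabilityP.imp {s Λ c₀ ℓ₀ κ₀ κ₀' : ℝ} {CanQ CanQ' : ℝ → (E3 ≃L[ℝ] E3) → (ℤ → E3) → Prop} (hκ : κ₀' ≤ κ₀)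
    (hC : ∀ a L w', CanQ' a L w' → CanQ a L w') (h : WordStabilityP s Λ c₀ ℓ₀ κ₀ CanQ) : WordStabilityP s Λ c₀ ℓ₀ κ₀' CanQ' :=
  fun a ha L w' hA hc => (h a ha L w' hA (hC a L w' hc)).of_le hκ

/-- ★★ **THE GLUE (PROVED)** `(RI♯-C-W) → (EE)(eStar + ν, Q) → U_Q(Can ∧ W ∧ Q) → (U♮-W-E)`: re-index the chart into the class (set equation, co-layer
separation, step bound), transport the chart's energy hypothesis to the word along the set equation, enclose it in `Q`, read coercivity off U_Q;
tameness `C₁ = max Λ ℓ₀` from `norm_gen_le` and the step clause. [g104] -/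
theorem uniformTameStabilityAtEIn_of_enclosure_of_cells {s Λ c₀ ℓ₀ κ₀ ν : ℝ} {W : Set ℝ} {Can Q : ℝ → (E3 ≃L[ℝ] E3) → (ℤ → E3) → Prop}
    (hRI : UniformReindexPCIn s Λ c₀ ℓ₀ Can W) (hEE : EnergyEnclosureP s Λ c₀ ℓ₀ (eStar + ν) Q W)
    (hUQ : WordStabilityP s Λ c₀ ℓ₀ κ₀ fun a L w' => Can a L w' ∧ a ∈ W ∧ Q a L w') : UniformTameStabilityAtEIn s Λ κ₀ c₀ (max Λ ℓ₀) ν W := by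
  intro a haW ha L w hLw hN
  obtain ⟨w', hset, hco, hlip, hcan⟩ := hRI a haW ha L w hLw
  have hadm : IsAdmissibleWord a s Λ c₀ ℓ₀ L w' := isAdmissibleWord_of_equilChart hLw hset hco hlip
  have hN' : IsEnergyNear ν (Layered (gen₁ L) (gen₂ L) w') := by rw [hset]; exact hN
  exact ⟨w', hset, hco, ⟨(norm_gen_le hadm).1.trans (le_max_left _ _), (norm_gen_le hadm).2.trans (le_max_left _ _),
    fun m => (hlip m).trans (le_max_right _ _)⟩, hUQ a ha L w' hadm ⟨hcan, haW, hEE a haW ha L w' hadm hN'⟩⟩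

/-- the (U♯-W-E) corollary (the statement licensed in r1937 (B)). [g104] -/
theorem uniformEquilStabilityAtEIn_of_enclosure_of_cells {s Λ c₀ ℓ₀ κ₀ ν : ℝ} {W : Set ℝ} {Can Q : ℝ → (E3 ≃L[ℝ] E3) → (ℤ → E3) → Prop}
    (hRI : UniformReindexPCIn s Λ c₀ ℓ₀ Can W) (hEE : EnergyEnclosureP s Λ c₀ ℓ₀ (eStar + ν) Q W)
    (hUQ : WordStabilityP s Λ c₀ ℓ₀ κ₀ fun a L w' => Can a L w' ∧ a ∈ W ∧ Q a L w') : UniformEquilStabilityAtEIn s Λ κ₀ c₀ ν W :=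
  (uniformTameStabilityAtEIn_of_enclosure_of_cells hRI hEE hUQ).toEquil

/-- ★★ **U_Q FROM THE ATLAS (PROVED)** — the budget half of ZZZYRE's `uniformEquilStabilityAtIn_of_atlasC` VERBATIM at word level: cells covering the
class `CanQ`, per-cell certificates and the budget leaves give `κ₀ = κ₁·cZ − γT` coercivity of every admissible word of the class. [g104] -/
theorem wordStabilityP_of_atlas {s Λ c₀ ℓ₀ r₁ ϱ R cZ κ₁ κ₀ γT : ℝ} {CanQ : ℝ → (E3 ≃L[ℝ] E3) → (ℤ → E3) → Prop}
    {InBox : ι → (E3 ≃L[ℝ] E3) → (ℤ → E3) → Prop} {c cK : ι → ℝ} {ΘR ΘN : ι → (E3 ≃L[ℝ] E3) → (ℤ → E3) → (Cell 2 × ℤ) × (Cell 2 × ℤ) → ℝ}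
    (h0 : 0 ≤ κ₁) (hκ : κ₀ ≤ κ₁ * cZ - γT) (hcK0 : ∀ i, 0 ≤ cK i) (hcK : ∀ i, cK i * c i ≤ 1)
    (hCS : CellSumP s Λ c₀ ℓ₀ r₁) (hNC : CellNullLagrangianP s Λ c₀ ℓ₀ r₁) (hcov : AtlasCoversPC s Λ c₀ ℓ₀ CanQ InBox)
    (hcell : ∀ i, BoxCellCertificateP s Λ c₀ ℓ₀ r₁ (InBox i) (c i)) (htail : ∀ i, BoxTailDebitP s Λ c₀ ℓ₀ ϱ (InBox i) (ΘR i) (ΘN i) γT)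
    (hPU : PartitionIdentityFullP s Λ c₀ ℓ₀ r₁ ϱ R) (hPD : PartitionIdentityDebitP s Λ c₀ ℓ₀ ϱ R)
    (hclus : ∀ i, BoxClusterCertificateDebitP s Λ c₀ ℓ₀ r₁ ϱ R (InBox i) (cK i) (ΘR i) (ΘN i) κ₁)
    (hCZ : IndexCurrencyP s Λ c₀ ℓ₀ r₁ cZ) : WordStabilityP s Λ c₀ ℓ₀ κ₀ CanQ := by
  intro a ha L w' hadm hc
  obtain ⟨i, hBi⟩ := hcov a ha L w' hadm hc
  intro φ hφ E hE
  obtain ⟨hK1, -⟩ := contactKorn_at ha hadm (hcK0 i) (hcK i) hCS hNC (hcell i a ha L w' hadm hBi) φ hφ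
  have hmain := halfBudget_at ha hadm hPU hPD (hclus i a ha L w' hadm hBi) φ hφ (htail i a ha L w' hadm hBi φ hφ E hE) hK1
  have hZ0 : 0 ≤ nnFormZ φ := finsum_nonneg fun x => by
    split_ifs <;> positivity
  exact coerciveZ_arith hmain (hCZ a ha L w' hadm φ hφ) hZ0 h0 hκ

/-- a cover of a class covers every subclass (the door of record's cover of `Can` covers `Can ∧ W ∧ Q`: the E-architecture asks LESS of the
atlas). [g104] -/
theorem atlasCoversPC_of_imp {s Λ c₀ ℓ₀ : ℝ} {Can Can' : ℝ → (E3 ≃L[ℝ] E3) → (ℤ → E3) → Prop} {InBox : ι → (E3 ≃L[ℝ] E3) → (ℤ → E3) → Prop}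
    (himp : ∀ a L w', Can' a L w' → Can a L w') (h : AtlasCoversPC s Λ c₀ ℓ₀ Can InBox) : AtlasCoversPC s Λ c₀ ℓ₀ Can' InBox :=
  fun a ha L w' hA hc => h a ha L w' hA (himp a L w' hc)

/-! ### §3 the glue to the column slot `hU : UniformTameStabilityE s Λ ν` (PROVED) -/

/-- **(ECOVER) «EnergyScaleCoverP s Λ ν W»** — every `ν`-energy-near equilibrium `s`-chart has its scale in `W` (EOS leaf; census EOS61: ν = 1/2000 ⇒
NN distance ∈ [0.9654, 0.9774]; at Λ = 2 the window must contain the coarse strata — index-3 and index-4 twins of energy-near charts are energy-near,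
same point set).  Energy-blind case = ZZZYRE's `ChartScaleCoverP` (`of_chartScaleCover`).  EOS-type · UNDECIDED · INSTRUMENTABLE. [g104] -/
def EnergyScaleCoverP (s Λ ν : ℝ) (W : Set ℝ) : Prop :=
  ∀ a : ℝ, 0 < a → ∀ (L : E3 ≃L[ℝ] E3) (w : ℤ → E3), IsEquilChart a s Λ L w → IsEnergyNear ν (LayeredHom (L : E3 →L[ℝ] E3) w) → a ∈ W

/-- the full window covers trivially. [g104] -/
theorem energyScaleCoverP_univ (s Λ ν : ℝ) : EnergyScaleCoverP s Λ ν Set.univ := fun a _ _ _ _ _ => Set.mem_univ a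

/-- an energy-blind scale cover (ZZZYRE) is an energy scale cover. [g104] -/
theorem EnergyScaleCoverP.of_chartScaleCover {s Λ ν : ℝ} {W₁ W₂ : Set ℝ} (h : ChartScaleCoverP s Λ W₁ W₂) :
    EnergyScaleCoverP s Λ ν (W₁ ∪ W₂) := fun a ha L w hE _ => h a ha L w hE

/-- (U♮-W-E) transports along an energy scale cover to every window. [g104] -/
theorem UniformTameStabilityAtEIn.of_cover {s Λ κ₀ c₀ C₁ ν : ℝ} {W W' : Set ℝ} (hcov : EnergyScaleCoverP s Λ ν W)
    (h : UniformTameStabilityAtEIn s Λ κ₀ c₀ C₁ ν W) : UniformTameStabilityAtEIn s Λ κ₀ c₀ C₁ ν W' :=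
  fun a _ ha L w hE hN => h a (hcov a ha L w hE hN) ha L w hE hN

/-- ★★ **THE GLUE TO THE COLUMN SLOT (PROVED)**: (U♮-W-E) with positive constants on `W` ∧ (ECOVER) on `W` ⇒ (U♮ᴱ) `UniformTameStabilityE s Λ ν` — the
hypothesis `hU` of the columns `_16XH17` … `_16XH28BP` BY NAME; line (D) reaches the column without (D₀) `TameReindex`. [g104] -/
theorem uniformTameStabilityE_of_atEIn {s Λ κ₀ c₀ C₁ ν : ℝ} {W : Set ℝ} (hκ : 0 < κ₀) (hc : 0 < c₀) (hC : 0 < C₁)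
    (h : UniformTameStabilityAtEIn s Λ κ₀ c₀ C₁ ν W) (hcov : EnergyScaleCoverP s Λ ν W) : UniformTameStabilityE s Λ ν :=
  fun a ha => ⟨κ₀, hκ, c₀, hc, C₁, hC, fun L w hE hN => h a (hcov a ha L w hE hN) ha L w hE hN⟩

/-- **(RECHART-E) «CoarseRechartTEP …»** — ZZZYRE's coarse re-chart leaf for the tame E-doors: fine-window tame E-stability ⇒ coarse-window tame
E-stability with degraded constants (ZZZYRF `transfer_twin₃/₄`: same point set — hence the same energy hypothesis — `c ↦ c/7`, `κ ↦ κ/116640`; the twin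
offsets are fine offsets plus in-plane generators, `C₁ ↦ 3·C₁`; identification leaf `TwinChartP`).  STRUCTURAL · WEAKER · ATTACKABLE-S. [g104] -/
def CoarseRechartTEP (s Λ κ₀ c₀ C₁ κ' c' C₁' ν : ℝ) (Wf Wc : Set ℝ) : Prop :=
  UniformTameStabilityAtEIn s Λ κ₀ c₀ C₁ ν Wf → UniformTameStabilityAtEIn s Λ κ' c' C₁' ν Wc

/-- ★★ **STRATA ASSEMBLY (PROVED)**: fine-window (U♮-W-E) ∧ (RECHART-E) ∧ (ECOVER) on `Wf ∪ Wc` ⇒ the column slot `UniformTameStabilityE s Λ ν`. [g104] -/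
theorem uniformTameStabilityE_of_fine_coarseE {s Λ κ₀ c₀ C₁ κ' c' C₁' ν : ℝ} {Wf Wc : Set ℝ} (hκ : 0 < κ₀) (hc : 0 < c₀) (hC : 0 < C₁)
    (hκ' : 0 < κ') (hc' : 0 < c') (hfine : UniformTameStabilityAtEIn s Λ κ₀ c₀ C₁ ν Wf)
    (hre : CoarseRechartTEP s Λ κ₀ c₀ C₁ κ' c' C₁' ν Wf Wc) (hcov : EnergyScaleCoverP s Λ ν (Wf ∪ Wc)) : UniformTameStabilityE s Λ ν :=
  uniformTameStabilityE_of_atEIn (lt_min hκ hκ') (lt_min hc hc') (hC.trans_le (le_max_left _ _)) (hfine.union (hre hfine)) hcov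

/-- DESIGNATE at the literals of record `(s, Λ, c₀, ℓ₀, ν) = (1/50, 2, 1/2, 3, 1/2000)`, `C₁ = max Λ ℓ₀`: fine certificate, coarse re-chart and energy scale
cover give `hU : UniformTameStabilityE (1/50) 2 (1/2000)` of `_16XH28BP`. [g104] -/
example {κ₀ κ' c' C₁' : ℝ} {Wf Wc : Set ℝ} (hκ : 0 < κ₀) (hκ' : 0 < κ') (hc' : 0 < c')
    (hfine : UniformTameStabilityAtEIn (1 / 50) 2 κ₀ (1 / 2) (max 2 3) (1 / 2000) Wf)
    (hre : CoarseRechartTEP (1 / 50) 2 κ₀ (1 / 2) (max 2 3) κ' c' C₁' (1 / 2000) Wf Wc)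
    (hcov : EnergyScaleCoverP (1 / 50) 2 (1 / 2000) (Wf ∪ Wc)) : UniformTameStabilityE (1 / 50) 2 (1 / 2000) :=
  uniformTameStabilityE_of_fine_coarseE hκ (by norm_num) (lt_max_of_lt_right (by norm_num)) hκ' hc' hfine hre hcov

end Summit.AtomisticToContinuum.Crystallization.Theorems.ChartedZeroExcessLayeredLatticeLiouville

end
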